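import Summits.CriticalPhenomena.PercolationContinuityZ3.Theorems.PercNearOneGluingNoHeavyLowerTailSahiThreeCopyTwoPointCertsK5Table

/-!
# Sahi's three-function conjecture — `k = 5` certificate checks, entries 2751–2912

COMPUTATIONAL (`native_decide`, integer arithmetic): the flow-form / face-form certificates of `certTable5` (`…TwoPointCertsK5Table`,
data `…TwoPointCertsK5Data*`) pass `checkEntry5` for the entries 2751 ≤ j < 2913 (chunks of 60).  Seat `prim-sahi-p1`, generation 61;
`--supports stmt-CriticalPhenomena-4575`. [this work]
-/

namespace Summit.CriticalPhenomena.PercolationContinuityZ3.Theorems.SahiThreeCopy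

/-- ★★ The certificates of `certTable5` pass the exact check — entries 2751–2810 (by evaluation). [this work] -/
theorem checkChunk5_2751 : checkChunk5 certTable5 upList5 (upSetsC 4) arrTab5 2751 60 = true := by
  native_decide

/-- ★★ The certificates of `certTable5` pass the exact check — entries 2811–2839 (by evaluation). [this work] -/
theorem checkChunk5_2811 : checkChunk5 certTable5 upList5 (upSetsC 4) arrTab5 2811 29 = true := by
  native_decide

/-- ★★ The certificates of `certTable5` pass the exact check — entries 2842–2849 (by evaluation). [this work] -/
theorem checkChunk5_2842 : checkChunk5 certTable5 upList5 (upSetsC 4) arrTab5 2842 8 = true := by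
  native_decide

/-- ★★ The certificates of `certTable5` pass the exact check — entries 2851–2851 (by evaluation). [this work] -/
theorem checkChunk5_2851 : checkChunk5 certTable5 upList5 (upSetsC 4) arrTab5 2851 1 = true := by
  native_decide

/-- ★★ The certificates of `certTable5` pass the exact check — entries 2853–2912 (by evaluation). [this work] -/
theorem checkChunk5_2853 : checkChunk5 certTable5 upList5 (upSetsC 4) arrTab5 2853 60 = true := by
  native_decide


end Summit.CriticalPhenomena.PercolationContinuityZ3.Theorems.SahiThreeCopy
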